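import Summits.CriticalPhenomena.SAWScalingLimit.Theorems.BoundaryClosureNegative_Instance
import Literature.Combinatorics.StablePolynomials.BasicProofs

/-!
# Negative knowledge on crux `BoundaryClosureR` (stmt-CriticalPhenomena-14004), part 1/5: the half-disc
re-marked `(pt 0, pt 1) = (0, r)` and the uniformiser `Ψ_r = -1/Φ_r : HD → ℍ` (`0 ↦ ∞`, `r ↦ 0`)

Support for `NormaliserPin.lean` (the normalisation point's lattice pin in `HexObservableLimitR` is
load-bearing: dead-end corridor ENDING at `b_δ`, root pinned at `bEdge → 0`).  Contents: the boundary
loop of the half-disc re-based at `0` (`bdry'`, `halfDiscJordan'`), the Dobrushin domain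
`halfDiscDomain' r` with `pt 0 = 0`, `pt 1 = r` (`pt_zero_halfDiscDomain'`, `pt_one_halfDiscDomain'`);
the inversion `invCE : z ↦ -1/z` of `ℍ`, `PsiCE r = (PhiCE r).trans invCE`, its rational form
`psiR r z = -(r-z)(1-rz)/((1-r)²z)` (`PsiCE_apply`), derivative `dpsiR r z = r(1-z²)/((1-r)²z²)`
(`deriv_PsiCE`), boundary behaviour (`tendsto_norm_PsiCE` at `0`, `tendsto_PsiCE_r` at `r`) and the
continuous logarithm `Mfun r z = log(r/(1-r)²) + Log(1-z²) - 2 Log z` of `Ψ_r'` (`exp_Mfun`,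
`continuousOn_Mfun`, `tendsto_Mfun_r`, `continuousOn_gM`).  Everything proved. [folklore]
-/

noncomputable section

open Set Filter Topology Complex
open Literature.Probability.RandomPlanarGeometry
open UpperHalfPlane (upperHalfPlaneSet)
open Literature.Probability.LatticeModels Literature.Probability.RandomPlanarGeometry.SAW

namespace Summit.CriticalPhenomena.SAWScalingLimit.Theorems.BoundaryClosureR.Negative

open BoundaryClosure.Negative

/-! ### The half-disc with marked points `0` (first) and `r ∈ (0,1)` (second) -/

/-- The boundary loop of the half-disc, re-based so that parameter `0` sits at the point `0`. [folklore] -/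
def bdry' (t : ℝ) : ℂ := bdry (t + 3 / 4)

/-- The re-based loop is continuous. [folklore] -/
theorem continuous_bdry' : Continuous bdry' := continuous_bdry.comp (continuous_id.add continuous_const)

/-- The re-based loop is `1`-periodic. [folklore] -/
theorem periodic_bdry' : Function.Periodic bdry' 1 := fun t => by
  unfold bdry'; rw [show t + 1 + 3 / 4 = (t + 3 / 4) + 1 by ring]; exact periodic_bdry _

/-- `bdry` only depends on the fractional part. [folklore] -/
theorem bdry_eq_bdry_fract (t : ℝ) : bdry t = bdry (Int.fract t) := by
  unfold bdry; rw [Int.fract_fract]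

/-- The re-based loop is injective on one period. [folklore] -/
theorem injOn_bdry' : InjOn bdry' (Ico 0 1) := by
  intro s hs t ht hst
  unfold bdry' at hst
  rw [bdry_eq_bdry_fract (s + 3 / 4), bdry_eq_bdry_fract (t + 3 / 4)] at hst
  have h := injOn_bdry ⟨Int.fract_nonneg _, Int.fract_lt_one _⟩ ⟨Int.fract_nonneg _, Int.fract_lt_one _⟩ hst
  -- `fract (s + 3/4) = fract (t + 3/4)` with `|s - t| < 1` forces `s = t`
  rw [Int.fract_eq_fract] at h
  obtain ⟨z, hz⟩ := h
  have hz' : (s - t : ℝ) = z := by linarith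
  have hlt : |(z : ℝ)| < 1 := by
    rw [← hz', abs_lt]; constructor <;> linarith [hs.1, hs.2, ht.1, ht.2]
  have hz0 : z = 0 := by
    have : |z| < 1 := by exact_mod_cast hlt
    exact Int.abs_lt_one_iff.mp this
  have : (s - t : ℝ) = 0 := by rw [hz', hz0]; simp
  linarith

/-- The re-based loop traces the frontier of the half-disc. [folklore] -/
theorem range_bdry' : range bdry' = frontier HD := by
  rw [← range_bdry]
  ext z
  constructor
  · rintro ⟨t, rfl⟩; exact ⟨t + 3 / 4, rfl⟩
  · rintro ⟨t, rfl⟩; exact ⟨t - 3 / 4, by unfold bdry'; rw [sub_add_cancel]⟩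

/-- **The upper half unit disc as a Jordan domain, boundary loop based at `0`.** [folklore] -/
def halfDiscJordan' : JordanDomain where
  carrier := HD
  boundary := bdry'
  isOpen := isOpen_HD
  isBounded := isBounded_HD
  isConnected := isConnected_HD
  continuous_boundary := continuous_bdry'
  periodic_boundary := periodic_bdry'
  injOn_boundary := injOn_bdry'
  range_boundary := range_bdry'

/-- **The half-disc with marked points `pt 0 = 0` and `pt 1 = r ∈ (0,1)`** (a Dobrushin domain;
parameters `0` and `1 - r/4`). [folklore] -/
def halfDiscDomain' (r : ℝ) (hr : 0 < r ∧ r < 1) : DobrushinDomain where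
  toJordanDomain := halfDiscJordan'
  mark := ![0, 1 - r / 4]
  strictMono_mark := by
    refine Fin.strictMono_iff_lt_succ.2 fun k => ?_
    fin_cases k
    simp; linarith [hr.2]
  mark_mem k := by
    fin_cases k
    · simp
    · simp; constructor <;> linarith [hr.1, hr.2]

/-- The carrier of the re-marked half-disc is `HD`. [folklore] -/
@[simp] theorem carrier_halfDiscDomain' (r : ℝ) (hr : 0 < r ∧ r < 1) :
    (halfDiscDomain' r hr).carrier = HD := rfl

/-- The first marked point is `0`. [folklore] -/
theorem pt_zero_halfDiscDomain' (r : ℝ) (hr : 0 < r ∧ r < 1) : (halfDiscDomain' r hr).pt 0 = 0 := by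
  show bdry' 0 = 0
  unfold bdry'
  rw [zero_add, bdry_eq_of_mem ⟨by norm_num, by norm_num⟩, bdryFun_of_gt (by norm_num)]
  push_cast; norm_num

/-- The second marked point is `r`. [folklore] -/
theorem pt_one_halfDiscDomain' (r : ℝ) (hr : 0 < r ∧ r < 1) : (halfDiscDomain' r hr).pt 1 = (r : ℂ) := by
  show bdry' (1 - r / 4) = r
  unfold bdry'
  rw [show 1 - r / 4 + 3 / 4 = (3 / 4 - r / 4) + 1 by ring, periodic_bdry,
    bdry_eq_of_mem ⟨by linarith [hr.2], by linarith [hr.1]⟩, bdryFun_of_gt (by linarith [hr.2])]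
  push_cast; ring

/-! ### The inversion `z ↦ -1/z` of the upper half-plane and `Ψ_r = -1/Φ_r` -/

/-- **The inversion** `z ↦ -1/z`, a conformal automorphism of the upper half-plane exchanging the
boundary points `0` and `∞`. [folklore] -/
def invCE : ConformalEquiv upperHalfPlaneSet upperHalfPlaneSet where
  toFun z := -z⁻¹
  invFun z := -z⁻¹
  source := upperHalfPlaneSet
  target := upperHalfPlaneSet
  map_source' z hz := Literature.Combinatorics.StablePolynomials.neg_inv_im_pos hz
  map_target' z hz := Literature.Combinatorics.StablePolynomials.neg_inv_im_pos hz
  left_inv' z _ := by rw [inv_neg, inv_inv, neg_neg]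
  right_inv' z _ := by rw [inv_neg, inv_inv, neg_neg]
  source_eq := rfl
  target_eq := rfl
  differentiableOn := by
    refine (differentiableOn_inv.mono ?_).neg
    intro z hz
    change 0 < z.im at hz
    show z ≠ 0
    rintro rfl; simp at hz
  differentiableOn_symm := by
    refine (differentiableOn_inv.mono ?_).neg
    intro z hz
    change 0 < z.im at hz
    show z ≠ 0
    rintro rfl; simp at hz

/-- **The conformal map `Ψ_r = -1/Φ_r` of the half-disc onto the upper half-plane** with `0 ↦ ∞`,
`r ↦ 0`. [folklore] -/
def PsiCE (r : ℝ) (hr : 0 < r ∧ r < 1) : ConformalEquiv HD upperHalfPlaneSet :=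
  (PhiCE r hr).trans invCE

/-- The rational function `Ψ_r(z) = -(r-z)(1-rz)/((1-r)² z)`. [folklore] -/
def psiR (r : ℝ) (z : ℂ) : ℂ := -(((r : ℂ) - z) * (1 - r * z)) / ((1 - r) ^ 2 * z)

/-- `z ≠ 0` on the half-disc. [folklore] -/
theorem ne_zero_of_mem_HD {z : ℂ} (hz : z ∈ HD) : z ≠ 0 := by
  rintro rfl; simp [HD] at hz

/-- `1 - r ≠ 0` in `ℂ` for `r < 1`. [folklore] -/
theorem one_sub_r_ne_zero {r : ℝ} (hr : 0 < r ∧ r < 1) : (1 : ℂ) - r ≠ 0 := by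
  intro h; have := congrArg Complex.re h; simp at this; linarith [hr.2]

/-- Unfolding `Ψ_r = -1/Φ_r`. [folklore] -/
theorem PsiCE_eq {r : ℝ} (hr : 0 < r ∧ r < 1) (z : ℂ) : PsiCE r hr z = -(PhiCE r hr z)⁻¹ := by
  unfold PsiCE; rw [ConformalEquiv.trans_apply]; rfl

/-- **`Ψ_r` is the rational function `psiR r` on the half-disc.** [folklore] -/
theorem PsiCE_apply {r : ℝ} (hr : 0 < r ∧ r < 1) {z : ℂ} (hz : z ∈ HD) : PsiCE r hr z = psiR r z := by
  rw [PsiCE_eq, PhiCE_apply hr hz, phiR, psiR, inv_div, neg_div]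

/-- The derivative `Ψ_r'(z) = r(1-z²)/((1-r)² z²)`. [folklore] -/
def dpsiR (r : ℝ) (z : ℂ) : ℂ := r * (1 - z ^ 2) / ((1 - r) ^ 2 * z ^ 2)

/-- `psiR r` has derivative `dpsiR r` away from `0`. [folklore] -/
theorem hasDerivAt_psiR {r : ℝ} (hr : 0 < r ∧ r < 1) {z : ℂ} (hz : z ≠ 0) :
    HasDerivAt (psiR r) (dpsiR r z) z := by
  have h1r := one_sub_r_ne_zero hr
  have hnum : HasDerivAt (fun y : ℂ => -(((r : ℂ) - y) * (1 - r * y)))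
      (-((0 - 1) * (1 - r * z) + ((r : ℂ) - z) * (0 - r * 1))) z :=
    (((hasDerivAt_const z (r : ℂ)).sub (hasDerivAt_id z)).mul
      ((hasDerivAt_const z (1 : ℂ)).sub ((hasDerivAt_id z).const_mul (r : ℂ)))).neg
  have hden : HasDerivAt (fun y : ℂ => ((1 : ℂ) - r) ^ 2 * y) ((1 - r) ^ 2 * 1) z :=
    (hasDerivAt_id z).const_mul _
  have h := hnum.div hden (mul_ne_zero (pow_ne_zero 2 h1r) hz)
  have e : (-((0 - 1) * (1 - ↑r * z) + (↑r - z) * (0 - ↑r * 1)) * ((1 - ↑r) ^ 2 * z) -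
      -((↑r - z) * (1 - ↑r * z)) * ((1 - ↑r) ^ 2 * 1)) / ((1 - ↑r) ^ 2 * z) ^ 2 = dpsiR r z := by
    unfold dpsiR
    rw [div_eq_div_iff (pow_ne_zero 2 (mul_ne_zero (pow_ne_zero 2 h1r) hz))
      (mul_ne_zero (pow_ne_zero 2 h1r) (pow_ne_zero 2 hz))]
    ring
  rw [e] at h
  exact h

/-- **The derivative of `Ψ_r` on the half-disc.** [folklore] -/
theorem deriv_PsiCE {r : ℝ} (hr : 0 < r ∧ r < 1) {z : ℂ} (hz : z ∈ HD) :
    deriv (PsiCE r hr) z = dpsiR r z := by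
  have hev : (fun x => PsiCE r hr x) =ᶠ[𝓝 z] psiR r := by
    filter_upwards [isOpen_HD.mem_nhds hz] with x hx using PsiCE_apply hr hx
  rw [hev.deriv_eq]
  exact (hasDerivAt_psiR hr (ne_zero_of_mem_HD hz)).deriv

/-- **`Ψ_r → ∞` at `0`** (in norm, within the half-disc). [folklore] -/
theorem tendsto_norm_PsiCE {r : ℝ} (hr : 0 < r ∧ r < 1) :
    Tendsto (fun x => ‖PsiCE r hr x‖) (𝓝[HD] (0 : ℂ)) atTop := by
  have e : (fun x => ‖PsiCE r hr x‖) = fun x => ‖PhiCE r hr x‖⁻¹ := by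
    funext x; rw [PsiCE_eq, norm_neg, norm_inv]
  rw [e]
  refine tendsto_inv_nhdsGT_zero.comp ?_
  have h0 := tendsto_PhiCE_zero hr
  unfold ConformalEquiv.HasBoundaryValue at h0
  rw [tendsto_nhdsWithin_iff]
  constructor
  · have := (continuous_norm.tendsto (0 : ℂ)).comp h0
    rwa [norm_zero] at this
  · refine eventually_nhdsWithin_of_forall fun x hx => ?_
    rw [mem_Ioi, norm_pos_iff]
    intro h
    have him : 0 < (PhiCE r hr x).im := (PhiCE r hr).mapsTo hx
    rw [h] at him; simp at him

/-- **`Ψ_r → 0` at `r`.** [folklore] -/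
theorem tendsto_PsiCE_r {r : ℝ} (hr : 0 < r ∧ r < 1) :
    (PsiCE r hr).HasBoundaryValue (r : ℂ) 0 := by
  unfold ConformalEquiv.HasBoundaryValue
  have h : Tendsto (fun x => -(PhiCE r hr x)⁻¹) (𝓝[HD] (r : ℂ)) (𝓝 0) := by
    rw [show (0 : ℂ) = -0 by simp]
    exact (tendsto_inv₀_cobounded.comp (tendsto_norm_atTop_iff_cobounded.1 (tendsto_norm_PhiCE hr))).neg
  exact h.congr fun x => (PsiCE_eq hr x).symm

/-- **A logarithm of `Ψ_r'`**: `M_r(z) = log(r/(1-r)²) + Log(1-z²) - 2 Log z`. [folklore] -/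
def Mfun (r : ℝ) (z : ℂ) : ℂ :=
  Complex.log ((r / (1 - r) ^ 2 : ℝ) : ℂ) + Complex.log (1 - z ^ 2) - 2 * Complex.log z

/-- Continuity of `M_r` where `1 - z²` and `z` avoid the negative real axis. [folklore] -/
theorem continuousAt_Mfun {r : ℝ} {z : ℂ} (h1 : 1 - z ^ 2 ∈ Complex.slitPlane)
    (h2 : z ∈ Complex.slitPlane) : ContinuousAt (Mfun r) z := by
  unfold Mfun
  refine (continuousAt_const.add ?_).sub ?_
  · exact ContinuousAt.clog (by fun_prop) h1
  · exact continuousAt_const.mul (ContinuousAt.clog continuousAt_id h2)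

/-- On the half-disc `z` avoids the negative real axis. [folklore] -/
theorem mem_slitPlane_of_mem_HD {z : ℂ} (hz : z ∈ HD) : z ∈ Complex.slitPlane :=
  Complex.mem_slitPlane_iff.2 (Or.inr hz.2.ne')

/-- **`M_r` is continuous on the half-disc.** [folklore] -/
theorem continuousOn_Mfun {r : ℝ} (hr : 0 < r ∧ r < 1) : ContinuousOn (Mfun r) HD := fun _ hz =>
  (continuousAt_Mfun (slit_of_mem_HD hr hz).1 (mem_slitPlane_of_mem_HD hz)).continuousWithinAt

/-- **`M_r` has the boundary value `M_r r` at `r`.** [folklore] -/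
theorem tendsto_Mfun_r {r : ℝ} (hr : 0 < r ∧ r < 1) :
    Tendsto (Mfun r) (𝓝[HD] (r : ℂ)) (𝓝 (Mfun r r)) := by
  have h1 : 1 - (r : ℂ) ^ 2 ∈ Complex.slitPlane := by
    rw [show (1 : ℂ) - (r : ℂ) ^ 2 = ((1 - r ^ 2 : ℝ) : ℂ) by push_cast; ring, Complex.ofReal_mem_slitPlane]
    nlinarith [hr.1, hr.2]
  have h2 : (r : ℂ) ∈ Complex.slitPlane := by rw [Complex.ofReal_mem_slitPlane]; exact hr.1
  exact (continuousAt_Mfun h1 h2).tendsto.mono_left nhdsWithin_le_nhds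

/-- **`exp M_r = Ψ_r'` on the half-disc.** [folklore] -/
theorem exp_Mfun {r : ℝ} (hr : 0 < r ∧ r < 1) {z : ℂ} (hz : z ∈ HD) :
    Complex.exp (Mfun r z) = deriv (PsiCE r hr) z := by
  rw [deriv_PsiCE hr hz, dpsiR, Mfun]
  have hz0 := ne_zero_of_mem_HD hz
  have h1 : (1 : ℂ) - z ^ 2 ≠ 0 := Complex.slitPlane_ne_zero (slit_of_mem_HD hr hz).1
  have h1r := one_sub_r_ne_zero hr
  have h0 : ((r / (1 - r) ^ 2 : ℝ) : ℂ) ≠ 0 := by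
    norm_cast; exact div_ne_zero hr.1.ne' (pow_ne_zero 2 (by linarith [hr.2]))
  rw [Complex.exp_sub, Complex.exp_add, Complex.exp_log h0, Complex.exp_log h1,
    show (2 : ℂ) * Complex.log z = ((2 : ℕ) : ℂ) * Complex.log z by norm_num,
    Complex.exp_nat_mul, Complex.exp_log hz0]
  have h1r' : (1 : ℝ) - r ≠ 0 := by linarith [hr.2]
  push_cast
  field_simp

/-- The predicted limit density `exp((5/8)(M_r - M_r r))` is continuous on the half-disc. [folklore] -/
theorem continuousOn_gM {r : ℝ} (hr : 0 < r ∧ r < 1) :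
    ContinuousOn (fun z => Complex.exp ((5 / 8 : ℂ) * (Mfun r z - Mfun r r))) HD :=
  Complex.continuous_exp.comp_continuousOn (continuousOn_const.mul ((continuousOn_Mfun hr).sub
    continuousOn_const))


end Summit.CriticalPhenomena.SAWScalingLimit.Theorems.BoundaryClosureR.Negative
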